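import Summits.MatrixMultiplication.OmegaCensus.USPWidth4Maxima
import Summits.MatrixMultiplication.OmegaCensus.StrongUSPWidth4Maxima
import Mathlib.Algebra.BigOperators.Fin
import HarnessLib

/-!
# ω-census, family (b′) STPP / USP: slices in general width — a USP of width 5 has at most 21 rows

HONEST FRAMING (pub-omega census; verbatim): lottery ticket; floor = certified bounds/negative ranges.
Census BOOKKEEPING — a (weak) certified negative range for the width-5 USP cell; plain USPs carry no `ω` bound.

The slice argument of `USPWidth4SliceGlue` in general width: the rows of a (strong) USP of width `k + 1` that share the symbol of a fixed
column form, with that column deleted, a (strong) USP of width `k` (`W4.pt_deleteCol_gen`); so `s_max(k + 1) ≤ 3 · s_max(k)`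
(`W4.PT.card_le_three_mul`, both kinds).  With `IsUSP.card_le_seven_of_width_four` (`USPWidth4Maxima`): **a USP of width 5 has at most 21 rows**
(`IsUSP.card_le_21_of_width_five`); the tree's `isUSP_14_5` (`USPTriangular`) gives 14, so the census range for `s_max^USP(5)` is `[14, 21]`
(`run/shared/lean/pub/pub-omega/pub-omega-stpp-1-g2/CENSUS-TABLE.md` §B: engines found 14-row USPs of width 5, exact maximum not claimed; not in print).
For strong USPs the same slicing gives only `≤ 15` at width 5 (print: 8, exhaustive) — recorded as the method's reach, not as census content.
-/

namespace Summit.MatrixMultiplication.OmegaCensus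

open Literature.Computability.AlgebraicComplexity Equiv

/-! ## Slices in general width: a (strong) USP of width `k + 1` has at most three times the maximum size at width `k` -/

/-- Deleting a CONSTANT column keeps a (strong) USP a (strong) USP, any width: a witnessing cell never sits in a constant column.
[cite: CohnKleinbergSzegedyUmans2005, §3 (p. 5), definition of a USP] -/
theorem W4.pt_deleteCol_gen {st : Bool} {s k : ℕ} {row : Fin s → Fin (k + 1) → Fin 3} (h : W4.PT st row) (i : Fin (k + 1)) (a : Fin 3)
    (hc : ∀ u, row u i = a) : W4.PT st (fun u (j : Fin k) => row u (i.succAbove j)) := by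
  intro π₁ π₂ π₃
  rcases h π₁ π₂ π₃ with heq | ⟨u, i', hx⟩
  · exact Or.inl heq
  · right
    have hne : i' ≠ i := by rintro rfl; rw [hc, hc, hc] at hx; exact W4.not_tst_self st a hx
    obtain ⟨j, hj⟩ := Fin.exists_succAbove_eq hne
    refine ⟨u, j, ?_⟩
    dsimp only
    rw [hj]; exact hx

/-- **Slice bound, general width, both kinds**: if every (strong) USP of width `k` has at most `M` rows, a (strong) USP of width `k + 1` has at
most `3M` rows — its rows split by the symbol in the last column into three slices, each (with that column deleted) a width-`k` puzzle of the
same kind. [cite: AndersonJiXu2020, Lemma 5 (arXiv:2301.00074v1 §3.5)] -/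
theorem W4.PT.card_le_three_mul {st : Bool} {s k M : ℕ} {row : Fin s → Fin (k + 1) → Fin 3} (h : W4.PT st row)
    (hM : ∀ (m : ℕ) (r : Fin m → Fin k → Fin 3), W4.PT st r → m ≤ M) : s ≤ 3 * M := by
  classical
  -- a set of rows constant in the last column has at most `M` elements
  have hF : ∀ (F : Finset (Fin s)) (c : Fin 3), (∀ u ∈ F, row u (Fin.last k) = c) → F.card ≤ M := fun F c hc => by
    let e : Fin F.card ≃ F := F.equivFin.symm
    let r : Fin F.card → Fin (k + 1) → Fin 3 := fun v j => row (e v).1 j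
    have hinj : Function.Injective fun v : Fin F.card => (e v).1 := fun v w hvw => e.injective (Subtype.ext hvw)
    have hr : W4.PT st r := h.restrict _ hinj
    have hconst : ∀ v, r v (Fin.last k) = c := fun v => hc _ (e v).2
    exact hM _ _ (W4.pt_deleteCol_gen hr (Fin.last k) c hconst)
  have hslice : ∀ c : Fin 3, (Finset.univ.filter fun u : Fin s => row u (Fin.last k) = c).card ≤ M :=
    fun c => hF _ c fun u hu => (Finset.mem_filter.1 hu).2
  have hsum : s = ∑ c : Fin 3, (Finset.univ.filter fun u : Fin s => row u (Fin.last k) = c).card := by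
    rw [← Finset.card_eq_sum_card_fiberwise (f := fun u : Fin s => row u (Fin.last k)) (s := Finset.univ) (t := Finset.univ)
      (fun _ _ => Finset.mem_univ _)]
    simp
  rw [hsum, Fin.sum_univ_three]
  have h0 := hslice 0; have h1 := hslice 1; have h2 := hslice 2
  omega

/-- The USP form of the slice bound. [cite: AndersonJiXu2020, Lemma 5 (arXiv:2301.00074v1 §3.5)] -/
theorem IsUSP.card_le_three_mul {s k M : ℕ} {row : Fin s → Fin (k + 1) → Fin 3} (h : IsUSP row)
    (hM : ∀ (m : ℕ) (r : Fin m → Fin k → Fin 3), IsUSP r → m ≤ M) : s ≤ 3 * M :=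
  W4.PT.card_le_three_mul ((W4.pt_false_iff row).2 h) fun m r hr => hM m r ((W4.pt_false_iff r).1 hr)

/-- The strong-USP form of the slice bound. [cite: AndersonJiXu2020, Lemma 5 (arXiv:2301.00074v1 §3.5)] -/
theorem IsStrongUSP.card_le_three_mul {s k M : ℕ} {row : Fin s → Fin (k + 1) → Fin 3} (h : IsStrongUSP row)
    (hM : ∀ (m : ℕ) (r : Fin m → Fin k → Fin 3), IsStrongUSP r → m ≤ M) : s ≤ 3 * M :=
  W4.PT.card_le_three_mul ((W4.pt_true_iff row).2 h) fun m r hr => hM m r ((W4.pt_true_iff r).1 hr)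

/-- **Width 5: a USP has at most 21 rows** (slices are width-4 USPs, `≤ 7` rows each by `IsUSP.card_le_seven_of_width_four`).  With
`isUSP_14_5` (USPTriangular) the census range for `s_max^USP(5)` is `[14, 21]`; not in print. [cite: AndersonJiXu2020, Table 1 (k = 5; USP column not in print)] -/
theorem IsUSP.card_le_21_of_width_five {s : ℕ} {row : Fin s → Fin 5 → Fin 3} (h : IsUSP row) : s ≤ 21 :=
  IsUSP.card_le_three_mul h fun _ _ hr => IsUSP.card_le_seven_of_width_four hr

/-- Width 5, strong: at most 15 rows from the slices alone (`IsStrongUSP.card_le_five_of_width_four`); print has the exhaustive value 8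
(AJX Table 1, `k = 5`), so this is only the slice method's reach, recorded for comparison. [cite: AndersonJiXu2020, Table 1 (k = 5)] -/
theorem IsStrongUSP.card_le_15_of_width_five {s : ℕ} {row : Fin s → Fin 5 → Fin 3} (h : IsStrongUSP row) : s ≤ 15 :=
  IsStrongUSP.card_le_three_mul h fun _ _ hr => IsStrongUSP.card_le_five_of_width_four hr

end Summit.MatrixMultiplication.OmegaCensus
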